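import Summits.NavierStokesRegularity.NavierStokesRegularity.Theorems.FilamentSkeletonRssCoreLinearInvertibilityCoreBoundLamZero
import Literature.Analysis.FluidPDE.PlanarPolarCoords

/-!
# Tools C for stub `stub_radialBlock` of crux `CoreLinearInvertibility`
# (stmt-NavierStokesRegularity-17973), line `Sketch`: radial calculus on the plane

Transfer between a RADIAL planar function `w(x) = W(|x|)` (`w ∈ C²(ℝ²)`, `w x = w y` whenever
`|x| = |y|`) and its profile along the ray through `e₀ = (1, 0)`,
`W(s) = w(s e₀)`, `W₁(s) = Dw(s e₀)[e₀]`, `W₂(s) = D²w(s e₀)[e₀, e₀]`: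

* `W' = W₁`, `W₁' = W₂`, `W₁(0) = 0` (evenness), continuity of `W₁` and of `s ↦ (L w)(s e₀)`;
* away from the origin: `Dw(x) = W₁(|x|) ⟨x/|x|, ·⟩`, `‖Dw(x)‖ = |W₁(|x|)|`,
  `Δw(x) = W₂(|x|) + W₁(|x|)/|x|`, hence the Gallay–Wayne operator
  `L = Δ + ½x·∇ + 1 = strainedVorticityOperator 0` acts by
  `(Lw)(x) = W₂ + W₁/r + (r/2) W₁ + W` at `r = |x|`;
* polar coordinates for radial integrands, `∫_{ℝ²} φ(|x|) dx = 2π ∫₀^∞ φ(ρ) ρ dρ`, and the passage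
  from `∫_{(0,∞)}` to `∫₀ᵇ` for integrands vanishing beyond `b`.
-/

set_option linter.dupNamespace false

noncomputable section

namespace Summit.NavierStokesRegularity.NavierStokesRegularity.Theorems

open MeasureTheory Filter Topology Set
open Literature.Analysis.FluidPDE
open Summit.AnomalousDissipation.AnomalousDissipation.Theorems.MarginalStabilityChainStretchedVortexRows
open scoped InnerProductSpace Laplacian ContDiff

/-! ### The norm away from the origin -/

/-- The planar norm is differentiable away from the origin with derivative `v ↦ ⟪x/|x|, v⟫`. [folklore] -/
theorem hasFDerivAt_norm_of_ne_zero {x : EuclideanSpace ℝ (Fin 2)} (hx : x ≠ 0) :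
    HasFDerivAt (fun y : EuclideanSpace ℝ (Fin 2) => ‖y‖) (‖x‖⁻¹ • innerSL ℝ x) x := by
  -- adapted from `Literature.Analysis.FluidPDE.CompressibleEulerExactSelfSimilarImplosion` (`hasFDerivAt_norm_of_ne`)
  have h1 : HasFDerivAt (fun y : EuclideanSpace ℝ (Fin 2) => ‖y‖ ^ 2) (2 • innerSL ℝ x) x :=
    (hasStrictFDerivAt_norm_sq x).hasFDerivAt
  have hn : ‖x‖ ≠ 0 := norm_ne_zero_iff.2 hx
  have h2 : HasDerivAt (fun t : ℝ => Real.sqrt t) (1 / (2 * Real.sqrt (‖x‖ ^ 2))) (‖x‖ ^ 2) :=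
    Real.hasDerivAt_sqrt (pow_ne_zero 2 hn)
  have h3 := h2.comp_hasFDerivAt x h1
  have heq : ((fun t : ℝ => Real.sqrt t) ∘ fun y : EuclideanSpace ℝ (Fin 2) => ‖y‖ ^ 2) =
      fun y => ‖y‖ := by
    funext y
    exact Real.sqrt_sq (norm_nonneg y)
  have hderiv : (1 / (2 * Real.sqrt (‖x‖ ^ 2))) • (2 • innerSL ℝ x) = ‖x‖⁻¹ • innerSL ℝ x := by
    ext v
    rw [Real.sqrt_sq (norm_nonneg x)]
    simp only [two_smul, FunLike.coe_smul, Pi.smul_apply, add_apply, smul_eq_mul]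
    field_simp
    ring
  rw [heq, hderiv] at h3
  exact h3

/-! ### The radial profile along the ray through `e₀` -/

/-- `|s e₀| = |s|`. [folklore] -/
theorem norm_smul_single_zero (s : ℝ) :
    ‖s • (EuclideanSpace.single 0 (1 : ℝ) : EuclideanSpace ℝ (Fin 2))‖ = |s| := by
  rw [norm_smul, PiLp.norm_single, norm_one, mul_one, Real.norm_eq_abs]

/-- `s ↦ s e₀` has velocity `e₀`. [folklore] -/
theorem hasDerivAt_smul_single_zero (s : ℝ) :
    HasDerivAt (fun t : ℝ => t • (EuclideanSpace.single 0 (1 : ℝ) : EuclideanSpace ℝ (Fin 2)))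
      (EuclideanSpace.single 0 (1 : ℝ)) s := by
  simpa using (hasDerivAt_id s).smul_const (EuclideanSpace.single (0 : Fin 2) (1 : ℝ))

section Profile

variable {w : EuclideanSpace ℝ (Fin 2) → ℝ} (hw : ContDiff ℝ 2 w)
  (hrad : ∀ x y : EuclideanSpace ℝ (Fin 2), ‖x‖ = ‖y‖ → w x = w y)

include hw in
/-- `W' = W₁`: the profile `W(s) = w(s e₀)` has derivative `W₁(s) = Dw(s e₀)[e₀]`. [folklore] -/
theorem hasDerivAt_radialProfile (s : ℝ) :
    HasDerivAt (fun t : ℝ => w (t • EuclideanSpace.single 0 1))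
      (fderiv ℝ w (s • EuclideanSpace.single 0 1) (EuclideanSpace.single 0 1)) s :=
  ((hw.differentiable two_ne_zero) _).hasFDerivAt.comp_hasDerivAt s (hasDerivAt_smul_single_zero s)

include hw in
/-- `W₁' = W₂`: `W₁(s) = Dw(s e₀)[e₀]` has derivative `W₂(s) = D²w(s e₀)[e₀, e₀]`. [folklore] -/
theorem hasDerivAt_radialProfile_deriv (s : ℝ) :
    HasDerivAt (fun t : ℝ => fderiv ℝ w (t • EuclideanSpace.single 0 1) (EuclideanSpace.single 0 1))
      (fderiv ℝ (fderiv ℝ w) (s • EuclideanSpace.single 0 1) (EuclideanSpace.single 0 1)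
        (EuclideanSpace.single 0 1)) s := by
  have h1 : ContDiff ℝ 1 fun y => fderiv ℝ w y (EuclideanSpace.single 0 1) :=
    contDiff_one_partialDeriv hw _
  have h := ((h1.differentiable one_ne_zero) _).hasFDerivAt.comp_hasDerivAt s
    (hasDerivAt_smul_single_zero s)
  rw [fderiv_partialDeriv_apply hw] at h
  exact h

include hw in
/-- `W₁` is continuous. [folklore] -/
theorem continuous_radialProfile_deriv :
    Continuous fun t : ℝ => fderiv ℝ w (t • EuclideanSpace.single 0 1) (EuclideanSpace.single 0 1) :=
  ((hw.continuous_fderiv two_ne_zero).clm_apply continuous_const).comp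
    (continuous_id.smul continuous_const)

include hw in
/-- `s ↦ (L_λ w)(s e₀)` is continuous. [folklore] -/
theorem continuous_radialProfile_op (lam : ℝ) :
    Continuous fun t : ℝ => strainedVorticityOperator lam w (t • EuclideanSpace.single 0 1) :=
  (continuous_strainedVorticityOperator hw lam).comp (continuous_id.smul continuous_const)

include hrad in
/-- A radial function is its profile of the norm: `w(x) = W(|x|)`. [folklore] -/
theorem radial_eq_profile (x : EuclideanSpace ℝ (Fin 2)) :
    w x = w (‖x‖ • EuclideanSpace.single 0 1) :=
  hrad _ _ (by rw [norm_smul_single_zero, abs_norm])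

include hrad in
/-- A radial function is even along the ray, so `W₁(0) = Dw(0)[e₀] = 0` (no differentiability
needed: `fderiv` is `0` at a point of non-differentiability). [folklore] -/
theorem radialProfile_deriv_zero :
    fderiv ℝ w ((0 : ℝ) • EuclideanSpace.single 0 1) (EuclideanSpace.single 0 1) = 0 := by
  set e : EuclideanSpace ℝ (Fin 2) := EuclideanSpace.single 0 1 with he
  have heven : (fun t : ℝ => w ((-t) • e)) = fun t => w (t • e) := by
    funext t
    exact hrad _ _ (by rw [neg_smul, norm_neg])
  by_cases hd : DifferentiableAt ℝ w ((0 : ℝ) • e)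
  · have h1 : HasDerivAt (fun t : ℝ => w (t • e)) (fderiv ℝ w ((0 : ℝ) • e) e) 0 :=
      hd.hasFDerivAt.comp_hasDerivAt (0 : ℝ) (hasDerivAt_smul_single_zero 0)
    have h2 : deriv (fun t : ℝ => w (t • e)) 0 = -deriv (fun t : ℝ => w (t • e)) 0 := by
      conv_lhs => rw [← heven]
      simpa using deriv_comp_neg (f := fun t : ℝ => w (t • e)) (x := (0 : ℝ))
    rw [← h1.deriv]
    linarith
  · rw [fderiv_zero_of_not_differentiableAt hd]
    rfl

include hw hrad in
/-- **Gradient of a radial function away from the origin**: `Dw(x) = W₁(|x|) ⟨x/|x|, ·⟩`. [folklore] -/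
theorem hasFDerivAt_radial {x : EuclideanSpace ℝ (Fin 2)} (hx : x ≠ 0) :
    HasFDerivAt w ((fderiv ℝ w (‖x‖ • EuclideanSpace.single 0 1) (EuclideanSpace.single 0 1)) •
      (‖x‖⁻¹ • innerSL ℝ x)) x := by
  have h := (hasDerivAt_radialProfile hw ‖x‖).comp_hasFDerivAt x (hasFDerivAt_norm_of_ne_zero hx)
  exact h.congr_of_eventuallyEq (Eventually.of_forall fun y => radial_eq_profile hrad y)

include hw hrad in
/-- `Dw(x)[v] = W₁(|x|) ⟪x, v⟫ / |x|` away from the origin. [folklore] -/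
theorem fderiv_radial_apply {x : EuclideanSpace ℝ (Fin 2)} (hx : x ≠ 0) (v : EuclideanSpace ℝ (Fin 2)) :
    fderiv ℝ w x v = fderiv ℝ w (‖x‖ • EuclideanSpace.single 0 1) (EuclideanSpace.single 0 1) *
      (‖x‖⁻¹ * ⟪x, v⟫_ℝ) := by
  rw [(hasFDerivAt_radial hw hrad hx).fderiv]
  simp only [FunLike.coe_smul, Pi.smul_apply, innerSL_apply_apply, smul_eq_mul]

include hw hrad in
/-- `‖Dw(x)‖ = |W₁(|x|)|` away from the origin. [folklore] -/
theorem norm_fderiv_radial {x : EuclideanSpace ℝ (Fin 2)} (hx : x ≠ 0) :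
    ‖fderiv ℝ w x‖ = |fderiv ℝ w (‖x‖ • EuclideanSpace.single 0 1) (EuclideanSpace.single 0 1)| := by
  rw [(hasFDerivAt_radial hw hrad hx).fderiv, norm_smul, norm_smul, innerSL_apply_norm, Real.norm_eq_abs,
    norm_inv, norm_norm, inv_mul_cancel₀ (norm_ne_zero_iff.2 hx), mul_one]

include hw hrad in
/-- **Laplacian of a radial function away from the origin**: `Δw(x) = W₂(|x|) + W₁(|x|)/|x|`
(`∂ᵢw = g xᵢ` with `g = W₁(|x|)/|x|` near `x`, `∑ᵢ ∂ᵢ(g xᵢ) = Dg[x] + 2g`). [folklore] -/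
theorem laplacian_radial {x : EuclideanSpace ℝ (Fin 2)} (hx : x ≠ 0) :
    Δ w x = fderiv ℝ (fderiv ℝ w) (‖x‖ • EuclideanSpace.single 0 1) (EuclideanSpace.single 0 1)
        (EuclideanSpace.single 0 1) +
      fderiv ℝ w (‖x‖ • EuclideanSpace.single 0 1) (EuclideanSpace.single 0 1) / ‖x‖ := by
  set e : EuclideanSpace ℝ (Fin 2) := EuclideanSpace.single 0 1 with he
  set W₁ : ℝ → ℝ := fun s => fderiv ℝ w (s • e) e with hW₁
  set W₂ : ℝ → ℝ := fun s => fderiv ℝ (fderiv ℝ w) (s • e) e e with hW₂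
  set g : EuclideanSpace ℝ (Fin 2) → ℝ := fun y => W₁ ‖y‖ / ‖y‖ with hg
  have hr : ‖x‖ ≠ 0 := norm_ne_zero_iff.2 hx
  have hS : HasDerivAt (fun s => W₁ s / s) ((W₂ ‖x‖ * ‖x‖ - W₁ ‖x‖ * 1) / ‖x‖ ^ 2) ‖x‖ :=
    (hasDerivAt_radialProfile_deriv hw ‖x‖).div (hasDerivAt_id ‖x‖) hr
  have hgd : HasFDerivAt g (((W₂ ‖x‖ * ‖x‖ - W₁ ‖x‖ * 1) / ‖x‖ ^ 2) • (‖x‖⁻¹ • innerSL ℝ x)) x :=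
    hS.comp_hasFDerivAt x (hasFDerivAt_norm_of_ne_zero hx)
  have hpart : ∀ i : Fin 2,
      (fun y => fderiv ℝ w y (EuclideanSpace.single i 1)) =ᶠ[𝓝 x] fun y => g y * y i := by
    intro i
    filter_upwards [isOpen_ne.mem_nhds hx] with y hy
    rw [fderiv_radial_apply hw hrad hy, EuclideanSpace.inner_single_right]
    simp only [hg, conj_trivial, one_mul]
    ring
  have hcoord : ∀ i : Fin 2, HasFDerivAt (fun y : EuclideanSpace ℝ (Fin 2) => y i)
      (EuclideanSpace.proj i : EuclideanSpace ℝ (Fin 2) →L[ℝ] ℝ) x := fun i =>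
    (EuclideanSpace.proj i : EuclideanSpace ℝ (Fin 2) →L[ℝ] ℝ).hasFDerivAt
  have hsum : ∀ i : Fin 2, fderiv ℝ (fun y => fderiv ℝ w y (EuclideanSpace.single i 1)) x
      (EuclideanSpace.single i 1) =
      g x + x i * (((W₂ ‖x‖ * ‖x‖ - W₁ ‖x‖ * 1) / ‖x‖ ^ 2) * (‖x‖⁻¹ * x i)) := by
    intro i
    rw [(hpart i).fderiv_eq, (hgd.fun_mul (hcoord i)).fderiv]
    simp only [add_apply, FunLike.coe_smul, Pi.smul_apply,
      innerSL_apply_apply, smul_eq_mul, EuclideanSpace.inner_single_right, conj_trivial, one_mul]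
    simp
  rw [laplacian_eq_sum_fderiv_fderiv (EuclideanSpace.basisFun (Fin 2) ℝ) hw x, Fin.sum_univ_two,
    EuclideanSpace.basisFun_apply, EuclideanSpace.basisFun_apply, hsum 0, hsum 1]
  have hn : ‖x‖ ^ 2 = x 0 ^ 2 + x 1 ^ 2 := by
    rw [EuclideanSpace.real_norm_sq_eq, Fin.sum_univ_two]
  simp only [hg]
  field_simp
  rw [hn]
  ring

include hw hrad in
/-- **The Gallay–Wayne operator on a radial function**, away from the origin:
`(Lw)(x) = W₂(r) + W₁(r)/r + (r/2) W₁(r) + W(r)`, `r = |x|`, `L = Δ + ½x·∇ + 1`. [folklore] -/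
theorem strainedVorticityOperator_zero_radial {x : EuclideanSpace ℝ (Fin 2)} (hx : x ≠ 0) :
    strainedVorticityOperator 0 w x =
      fderiv ℝ (fderiv ℝ w) (‖x‖ • EuclideanSpace.single 0 1) (EuclideanSpace.single 0 1)
          (EuclideanSpace.single 0 1) +
        fderiv ℝ w (‖x‖ • EuclideanSpace.single 0 1) (EuclideanSpace.single 0 1) / ‖x‖ +
        ‖x‖ / 2 * fderiv ℝ w (‖x‖ • EuclideanSpace.single 0 1) (EuclideanSpace.single 0 1) +
        w (‖x‖ • EuclideanSpace.single 0 1) := by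
  have hr : ‖x‖ ≠ 0 := norm_ne_zero_iff.2 hx
  have hn : ‖x‖ ^ 2 = x 0 ^ 2 + x 1 ^ 2 := by
    rw [EuclideanSpace.real_norm_sq_eq, Fin.sum_univ_two]
  rw [strainedVorticityOperator, laplacian_radial hw hrad hx, fderiv_radial_apply hw hrad hx,
    fderiv_radial_apply hw hrad hx, EuclideanSpace.inner_single_right, EuclideanSpace.inner_single_right,
    ← radial_eq_profile hrad x]
  simp only [conj_trivial, one_mul]
  field_simp
  rw [hn]
  ring

end Profile

/-! ### Polar coordinates for radial integrands -/

/-- **Polar coordinates for a radial integrand**: if `g ∈ L¹(ℝ²)` and `g(x) = φ(|x|)` for `x ≠ 0`,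
then `∫ g = 2π ∫_{(0,∞)} φ(ρ) ρ dρ`. [folklore] -/
theorem integral_radial_eq_two_pi_mul {g : EuclideanSpace ℝ (Fin 2) → ℝ} {φ : ℝ → ℝ} (hg : Integrable g)
    (hgφ : ∀ x, x ≠ 0 → g x = φ ‖x‖) :
    ∫ x, g x = 2 * Real.pi * ∫ ρ in Ioi (0 : ℝ), φ ρ * ρ := by
  rw [integral_eq_integral_circlePt hg]
  have h : ∀ ρ ∈ Ioi (0 : ℝ), ∫ θ in Ioc (-Real.pi) Real.pi, ρ • g (circlePt ρ θ) = 2 * Real.pi * (φ ρ * ρ) := by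
    intro ρ hρ
    have hρ' : 0 < ρ := hρ
    have hval : ∀ θ : ℝ, ρ • g (circlePt ρ θ) = φ ρ * ρ := fun θ => by
      have hne : circlePt ρ θ ≠ 0 := by
        intro h0
        have := congrArg (fun z : EuclideanSpace ℝ (Fin 2) => ‖z‖) h0
        simp only [norm_circlePt, norm_zero, abs_of_pos hρ'] at this
        exact hρ'.ne' this
      rw [smul_eq_mul, hgφ _ hne, norm_circlePt, abs_of_pos hρ', mul_comm]
    simp_rw [hval]
    rw [setIntegral_const, Real.volume_real_Ioc_of_le (by linarith [Real.pi_pos]), smul_eq_mul]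
    ring
  rw [setIntegral_congr_fun measurableSet_Ioi h, integral_const_mul]

/-- From the half-line to an interval, for an integrand vanishing beyond `b ≥ 0`:
`∫_{(0,∞)} f = ∫₀ᵇ f`. [folklore] -/
theorem setIntegral_Ioi_eq_intervalIntegral {f : ℝ → ℝ} {b : ℝ} (hb : 0 ≤ b) (hf : ∀ r, b < r → f r = 0) :
    ∫ r in Ioi (0 : ℝ), f r = ∫ r in 0..b, f r := by
  rw [intervalIntegral.integral_of_le hb]
  refine setIntegral_eq_of_subset_of_forall_sdiff_eq_zero measurableSet_Ioi Ioc_subset_Ioi_self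
    fun r hr => hf r ?_
  have h1 : 0 < r := hr.1
  have h2 : ¬(0 < r ∧ r ≤ b) := hr.2
  push Not at h2
  exact lt_of_not_ge fun h => (h2 h1).not_ge h


/-- Registered tools stub of crux stmt-NavierStokesRegularity-17973 (`stub_radialBlockToolsC`):
radial calculus on the plane — the profile derivatives `W' = W₁`, `W₁' = W₂`, `W₁(0) = 0`, the
gradient norm and the Laplacian of a radial `C²` function away from the origin, the Gallay–Wayne
operator on the ray, polar coordinates for radial integrands, and `∫_{(0,∞)} = ∫₀ᵇ`. [folklore] -/
theorem stub_radialBlockToolsC :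
    (∀ (w : EuclideanSpace ℝ (Fin 2) → ℝ), ContDiff ℝ 2 w → ∀ s : ℝ,
      HasDerivAt (fun t : ℝ => w (t • EuclideanSpace.single 0 1))
        (fderiv ℝ w (s • EuclideanSpace.single 0 1) (EuclideanSpace.single 0 1)) s ∧
      HasDerivAt (fun t : ℝ => fderiv ℝ w (t • EuclideanSpace.single 0 1) (EuclideanSpace.single 0 1))
        (fderiv ℝ (fderiv ℝ w) (s • EuclideanSpace.single 0 1) (EuclideanSpace.single 0 1)
          (EuclideanSpace.single 0 1)) s) ∧
    (∀ (w : EuclideanSpace ℝ (Fin 2) → ℝ), ContDiff ℝ 2 w →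
      (∀ x y : EuclideanSpace ℝ (Fin 2), ‖x‖ = ‖y‖ → w x = w y) →
      fderiv ℝ w ((0 : ℝ) • EuclideanSpace.single 0 1) (EuclideanSpace.single 0 1) = 0 ∧
      ∀ x : EuclideanSpace ℝ (Fin 2), x ≠ 0 →
        ‖fderiv ℝ w x‖ = |fderiv ℝ w (‖x‖ • EuclideanSpace.single 0 1) (EuclideanSpace.single 0 1)| ∧
        Δ w x = fderiv ℝ (fderiv ℝ w) (‖x‖ • EuclideanSpace.single 0 1) (EuclideanSpace.single 0 1)
            (EuclideanSpace.single 0 1) +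
          fderiv ℝ w (‖x‖ • EuclideanSpace.single 0 1) (EuclideanSpace.single 0 1) / ‖x‖ ∧
        strainedVorticityOperator 0 w x =
          fderiv ℝ (fderiv ℝ w) (‖x‖ • EuclideanSpace.single 0 1) (EuclideanSpace.single 0 1)
              (EuclideanSpace.single 0 1) +
            fderiv ℝ w (‖x‖ • EuclideanSpace.single 0 1) (EuclideanSpace.single 0 1) / ‖x‖ +
            ‖x‖ / 2 * fderiv ℝ w (‖x‖ • EuclideanSpace.single 0 1) (EuclideanSpace.single 0 1) +
            w (‖x‖ • EuclideanSpace.single 0 1)) ∧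
    (∀ (g : EuclideanSpace ℝ (Fin 2) → ℝ) (φ : ℝ → ℝ), Integrable g → (∀ x, x ≠ 0 → g x = φ ‖x‖) →
      ∫ x, g x = 2 * Real.pi * ∫ ρ in Set.Ioi (0 : ℝ), φ ρ * ρ) ∧
    (∀ (f : ℝ → ℝ) (b : ℝ), 0 ≤ b → (∀ r, b < r → f r = 0) →
      ∫ r in Set.Ioi (0 : ℝ), f r = ∫ r in 0..b, f r) :=
  ⟨fun _ hw s => ⟨hasDerivAt_radialProfile hw s, hasDerivAt_radialProfile_deriv hw s⟩,
    fun _ hw hrad => ⟨radialProfile_deriv_zero hrad, fun _ hx =>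
      ⟨norm_fderiv_radial hw hrad hx, laplacian_radial hw hrad hx,
        strainedVorticityOperator_zero_radial hw hrad hx⟩⟩,
    fun _ _ hg hgφ => integral_radial_eq_two_pi_mul hg hgφ,
    fun _ _ hb hf => setIntegral_Ioi_eq_intervalIntegral hb hf⟩

end Summit.NavierStokesRegularity.NavierStokesRegularity.Theorems
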